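import Literature.Combinatorics.Enumerative.GlynnFormula
import Literature.Analysis.Matrix.HadamardInequality
import Mathlib.Analysis.Complex.Basic
import HarnessLib

/-!
# Gurvits's bound `|Per V| ≤ ‖V‖ⁿ` via the Glynn estimator (Aaronson–Arkhipov, Appendix 12)

Topic `Literature/Analysis/Matrix` (pub-qadeq lane, boson-sampling rows E-11…E-15: the classical
ADDITIVE-error side — "an efficient randomized algorithm to approximate the permanent of a
(sub)unitary matrix with ±1/poly(n) additive error" — and the reason every boson-sampling outcome
probability `|Per(U_{S,T})|²` is at most `1`).

HONEST FRAMING: instance-level adjudication of specific advantage claims; no claim about BQP vs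
BPP or the summit. This file proves two printed inequalities about permanents of complex matrices;
it says nothing about any experiment.

## Source

S. Aaronson, A. Arkhipov, *The computational complexity of linear optics*, STOC 2011 (full version
arXiv:1011.3245 = Theory of Computing 9 (2013) 143–252), Appendix 12 "Positive results for simulation
of linear optics" [AaronsonArkhipov2011] (read via `lit read arxiv:1011.3245`, tex chunks p0059–p0060;
the lemma numbers below are those of the full version), presenting L. Gurvits, *On the complexity of
mixed discriminants and related problems*, MFCS 2005, 447–458:

* Lemma 63 (Ryser's/Glynn's formula as an expectation): `Per(V) = E_{x∈{−1,1}ⁿ}[x_1⋯x_n Π_i (v_{i1}x_1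
  + ⋯ + v_{in}x_n)]`, with the estimator `Rys_x(V) := x_1⋯x_n Π_i (v_{i1}x_1 + ⋯ + v_{in}x_n)` — in
  the tree as `Literature.Combinatorics.Enumerative.sum_signVec_prod_eq_two_pow_mul_permanent`
  (`GlynnFormula.lean`: `Σ_δ (Π_k δ_k) Π_i Σ_j δ_j a_ij = 2^N per A`), restated below as
  `permanent_eq_avg_glynnEstimator`;
* Lemma 64: "`|Rys_x(V)| ≤ ‖V‖ⁿ` for all `x ∈ {−1,1}ⁿ` and all `V`." Proof as printed: `y = Vx`,
  `‖x‖ = √n`, so `‖y‖ ≤ ‖V‖√n`; `|Rys_x(V)| = |y_1⋯y_n| ≤ ((|y_1|+⋯+|y_n|)/n)ⁿ ≤ (‖y‖/√n)ⁿ ≤ ‖V‖ⁿ`,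
  "where the third line follows from the arithmetic-geometric mean inequality, and the fourth line
  follows from Cauchy-Schwarz" — `norm_glynnEstimator_le` (we apply AM–GM — the tree's
  `Literature.Analysis.Matrix.prod_le_arith_mean_pow` — to the squares `|y_i|²`, which merges the two
  printed steps);
* Corollary 65: "`|Per(V)| ≤ ‖V‖ⁿ` for all `V`" — `norm_permanent_le_pow`.

The operator norm `‖V‖` enters only through the printed inequality `‖Vx‖ ≤ ‖V‖‖x‖`; we therefore take
a constant `c ≥ 0` with `Σ_i |Σ_j V_ij x_j|² ≤ c² Σ_j |x_j|²` for all `x` as the HYPOTHESIS (any bound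
on the `ℓ²→ℓ²` operator norm), which keeps the statements free of a choice of matrix-norm instance.
`sum_norm_sq_submatrix_mulVec_le` supplies that hypothesis with `c = 1` for any square submatrix
(distinct rows and columns) of a unitary, whence `norm_permanent_submatrix_unitary_le_one`:
`|Per(U_{S,T})| ≤ 1`. NOT formalised: Theorem 66 (the `O(n²/ε²)` sampling algorithm — a
Chebyshev/Hoeffding average of `Rys_x`; its range bound is Lemma 64) and Gurvits's `k`-photon marginal
algorithm.

## References

* [AaronsonArkhipov2011] S. Aaronson, A. Arkhipov, STOC 2011, 333–342, doi:10.1145/1993636.1993682;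
  full version arXiv:1011.3245 / Theory of Computing 9 (2013), Appendix 12, Lemmas 63–64,
  Corollary 65, Theorem 66.
* L. Gurvits, MFCS 2005, LNCS 3618, 447–458 (the original source of Lemma 64 / Theorem 66, as
  credited by Aaronson–Arkhipov).
-/

noncomputable section

open Finset Literature.Combinatorics.Enumerative

namespace Literature.Analysis.Matrix

variable {ι : Type*} [Fintype ι] [DecidableEq ι]

/-! ### The Glynn / Gurvits estimator -/

/-- The estimator `Rys_x(V) := x_1⋯x_n · Π_i (v_{i1}x_1 + ⋯ + v_{in}x_n)` for the sign vector
`x = signVec s ∈ {±1}^ι` (`−1` exactly on `s`). [cite: AaronsonArkhipov2011, App. 12 (display defining Rys_x(V), after Lemma 63 of the full version arXiv:1011.3245)] -/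
def glynnEstimator (V : _root_.Matrix ι ι ℂ) (s : Finset ι) : ℂ :=
  (∏ k, (signVec s k : ℂ)) * ∏ i, ∑ j, signVec s j * V i j

/-- **Lemma 63** (the estimator is unbiased): `Per(V) = 2^{-n} Σ_{x∈{±1}ⁿ} Rys_x(V)`, i.e.
`E_x[Rys_x(V)] = Per(V)` — the tree's BB/FG–Glynn sign sum divided by `2ⁿ`.
[cite: AaronsonArkhipov2011, App. 12 Lemma 63 (full version)] -/
theorem permanent_eq_avg_glynnEstimator (V : _root_.Matrix ι ι ℂ) :
    V.permanent = ((2 : ℂ) ^ Fintype.card ι)⁻¹ * ∑ s : Finset ι, glynnEstimator V s := by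
  have h := sum_signVec_prod_eq_two_pow_mul_permanent V
  simp only [glynnEstimator]
  rw [h, ← mul_assoc, inv_mul_cancel₀ (pow_ne_zero _ two_ne_zero), one_mul]

omit [Fintype ι] in
/-- The sign vectors have unimodular entries: `‖(signVec s k : ℂ)‖ = 1`. [folklore] -/
private theorem norm_signVec (s : Finset ι) (k : ι) : ‖(signVec s k : ℂ)‖ = 1 := by
  rw [signVec_apply]
  split_ifs <;> simp

/-- **Lemma 64 (Gurvits)**: `|Rys_x(V)| ≤ ‖V‖ⁿ` for all `x ∈ {−1,1}ⁿ` — here for any constant `c ≥ 0`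
bounding the operator norm in the printed sense `‖Vx‖ ≤ c‖x‖` (hypothesis `hV`, squared form).
Proof as printed (AM–GM on the `|y_i|`, Cauchy–Schwarz, `‖x‖ = √n`), with AM–GM applied to `|y_i|²`.
[cite: AaronsonArkhipov2011, App. 12 Lemma 64 (full version arXiv:1011.3245)] -/
theorem norm_glynnEstimator_le (V : _root_.Matrix ι ι ℂ) {c : ℝ} (hc : 0 ≤ c)
    (hV : ∀ x : ι → ℂ, ∑ i, ‖∑ j, V i j * x j‖ ^ 2 ≤ c ^ 2 * ∑ j, ‖x j‖ ^ 2) (s : Finset ι) :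
    ‖glynnEstimator V s‖ ≤ c ^ Fintype.card ι := by
  set n := Fintype.card ι with hn
  -- the vector `y = V x` for the sign vector `x`
  set y : ι → ℂ := fun i => ∑ j, signVec s j * V i j with hy
  have hsign : ‖∏ k, (signVec s k : ℂ)‖ = 1 := by
    rw [norm_prod]; exact Finset.prod_eq_one fun k _ => norm_signVec s k
  have hyV : ∀ i, y i = ∑ j, V i j * (signVec s j : ℂ) := fun i =>
    Finset.sum_congr rfl fun j _ => mul_comm _ _
  -- Cauchy–Schwarz step: `Σ |y_i|² ≤ c² n`
  have hsum : ∑ i, ‖y i‖ ^ 2 ≤ c ^ 2 * n := by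
    have h := hV (fun j => (signVec s j : ℂ))
    simp only [norm_signVec, one_pow, Finset.sum_const, Finset.card_univ, nsmul_eq_mul, mul_one] at h
    simpa only [hyV] using h
  -- the empty register: `Rys = 1 ≤ c⁰`
  rcases Nat.eq_zero_or_pos n with h0 | hpos
  · haveI : IsEmpty ι := Fintype.card_eq_zero_iff.mp (hn ▸ h0)
    simp [glynnEstimator, h0]
  -- AM–GM on the squares (the tree's `prod_le_arith_mean_pow`, `HadamardInequality.lean`)
  have hz : ∀ i, 0 ≤ ‖y i‖ ^ 2 := fun i => by positivity
  have hprod_sq : (∏ i, ‖y i‖) ^ 2 ≤ (c ^ n) ^ 2 := by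
    rw [← Finset.prod_pow]
    refine (prod_le_arith_mean_pow (fun i => ‖y i‖ ^ 2) hz (hn ▸ hpos)).trans ?_
    rw [← hn, ← pow_mul, mul_comm n 2, pow_mul]
    apply pow_le_pow_left₀ (div_nonneg (Finset.sum_nonneg fun i _ => hz i) (Nat.cast_nonneg _))
    rw [div_le_iff₀ (by exact_mod_cast hpos)]
    exact hsum
  have hprod : ∏ i, ‖y i‖ ≤ c ^ n :=
    (sq_le_sq₀ (Finset.prod_nonneg fun i _ => norm_nonneg _) (pow_nonneg hc _)).mp hprod_sq
  calc ‖glynnEstimator V s‖ = ‖∏ k, (signVec s k : ℂ)‖ * ∏ i, ‖y i‖ := by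
        rw [glynnEstimator, norm_mul, norm_prod, norm_prod]
    _ ≤ c ^ n := by rw [hsign, one_mul]; exact hprod

/-- **Corollary 65 (Gurvits's bound)**: `|Per(V)| ≤ ‖V‖ⁿ` — for any `c ≥ 0` with `‖Vx‖ ≤ c‖x‖` for all
`x`, `|Per V| ≤ cⁿ` (average of Lemma 64 over the `2ⁿ` sign vectors). In particular every matrix with
operator norm `≤ 1` — e.g. any submatrix of a unitary — has `|Per V| ≤ 1`.
[cite: AaronsonArkhipov2011, App. 12 Corollary 65 (full version arXiv:1011.3245)] -/
theorem norm_permanent_le_pow (V : _root_.Matrix ι ι ℂ) {c : ℝ} (hc : 0 ≤ c)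
    (hV : ∀ x : ι → ℂ, ∑ i, ‖∑ j, V i j * x j‖ ^ 2 ≤ c ^ 2 * ∑ j, ‖x j‖ ^ 2) :
    ‖V.permanent‖ ≤ c ^ Fintype.card ι := by
  rw [permanent_eq_avg_glynnEstimator, norm_mul, norm_inv, norm_pow, Complex.norm_two]
  have h2 : (0 : ℝ) < (2 : ℝ) ^ Fintype.card ι := by positivity
  calc ((2 : ℝ) ^ Fintype.card ι)⁻¹ * ‖∑ s : Finset ι, glynnEstimator V s‖
      ≤ ((2 : ℝ) ^ Fintype.card ι)⁻¹ * ∑ s : Finset ι, ‖glynnEstimator V s‖ :=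
        mul_le_mul_of_nonneg_left (norm_sum_le _ _) (by positivity)
    _ ≤ ((2 : ℝ) ^ Fintype.card ι)⁻¹ * ∑ _s : Finset ι, c ^ Fintype.card ι :=
        mul_le_mul_of_nonneg_left (Finset.sum_le_sum fun s _ => norm_glynnEstimator_le V hc hV s)
          (by positivity)
    _ = c ^ Fintype.card ι := by
        rw [Finset.sum_const, Finset.card_univ, Fintype.card_finset, nsmul_eq_mul]
        push_cast
        field_simp

/-! ### Submatrices of a unitary: every boson-sampling amplitude has modulus `≤ 1` -/

open _root_.Matrix

omit [DecidableEq ι] in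
/-- `Σ_i ‖v_i‖² = Re ⟨v, v⟩`. [folklore] -/
private theorem sum_norm_sq_eq_re_dot {m : Type*} [Fintype m] (v : m → ℂ) :
    ∑ i, ‖v i‖ ^ 2 = (star v ⬝ᵥ v).re := by
  simp only [dotProduct, Pi.star_apply, Complex.re_sum]
  refine Finset.sum_congr rfl fun i _ => ?_
  rw [Complex.star_def, Complex.conj_mul']
  norm_cast

omit [Fintype ι] [DecidableEq ι] in
/-- Unitary matrices preserve `Σ_i ‖v_i‖²` (as `PolynomialMethod.sum_norm_sq_mulVec_of_mem_unitaryGroup`,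
re-proved here to keep the import light). [folklore] -/
private theorem sum_norm_sq_mulVec_unitary {m : Type*} [Fintype m] [DecidableEq m]
    {U : _root_.Matrix m m ℂ} (hU : U ∈ _root_.Matrix.unitaryGroup m ℂ) (v : m → ℂ) :
    ∑ i, ‖(U *ᵥ v) i‖ ^ 2 = ∑ i, ‖v i‖ ^ 2 := by
  have h1 : Uᴴ * U = 1 := by
    simpa [Matrix.star_eq_conjTranspose] using Matrix.mem_unitaryGroup_iff'.mp hU
  rw [sum_norm_sq_eq_re_dot, sum_norm_sq_eq_re_dot, Matrix.star_mulVec, Matrix.dotProduct_mulVec,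
    Matrix.vecMul_vecMul, h1, Matrix.vecMul_one]

omit [DecidableEq ι] in
/-- **A submatrix of a unitary is a contraction**: for a unitary `U` and injective row/column selections
`f, g`, the matrix `V_ij = U_{f i, g j}` satisfies `‖Vx‖ ≤ ‖x‖` — the printed hypothesis of Lemma 64 /
Corollary 65 with `‖V‖ ≤ 1` ("the permanent of a (sub)unitary matrix").
[cite: AaronsonArkhipov2011, App. 12 (first paragraph: Per(U_{n,n}) for a (sub)unitary matrix)] -/
theorem sum_norm_sq_submatrix_mulVec_le {m : Type*} [Fintype m] [DecidableEq m]
    {U : _root_.Matrix m m ℂ} (hU : U ∈ _root_.Matrix.unitaryGroup m ℂ) {f g : ι → m}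
    (hf : Function.Injective f) (hg : Function.Injective g) (x : ι → ℂ) :
    ∑ i, ‖∑ j, U (f i) (g j) * x j‖ ^ 2 ≤ (1 : ℝ) ^ 2 * ∑ j, ‖x j‖ ^ 2 := by
  classical
  -- extend `x` by zero along the injective column map `g`
  set xt : m → ℂ := fun k => ∑ j, if g j = k then x j else 0 with hxt
  have hrow : ∀ r, ∑ j, U r (g j) * x j = (U *ᵥ xt) r := by
    intro r
    simp only [Matrix.mulVec, dotProduct, hxt, Finset.mul_sum, mul_ite, mul_zero]
    rw [Finset.sum_comm]
    refine Finset.sum_congr rfl fun j _ => ?_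
    rw [Finset.sum_ite_eq, if_pos (Finset.mem_univ _)]
  have hxt_g : ∀ j, xt (g j) = x j := by
    intro j
    simp only [hxt]
    rw [Finset.sum_eq_single j]
    · rw [if_pos rfl]
    · intro j' _ hj'; rw [if_neg (fun h => hj' (hg h))]
    · intro h; exact absurd (Finset.mem_univ j) h
  have hxt_zero : ∀ k, k ∉ Finset.univ.image g → xt k = 0 := by
    intro k hk
    simp only [hxt]
    refine Finset.sum_eq_zero fun j _ => if_neg fun h => hk ?_
    exact Finset.mem_image.2 ⟨j, Finset.mem_univ j, h⟩
  have hnorm_xt : ∑ k, ‖xt k‖ ^ 2 = ∑ j, ‖x j‖ ^ 2 := by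
    rw [← Finset.sum_subset (Finset.subset_univ (Finset.univ.image g))
      (fun k _ hk => by rw [hxt_zero k hk, norm_zero, zero_pow two_ne_zero]),
      Finset.sum_image (fun j _ j' _ h => hg h)]
    exact Finset.sum_congr rfl fun j _ => by rw [hxt_g]
  calc ∑ i, ‖∑ j, U (f i) (g j) * x j‖ ^ 2 = ∑ i, ‖(U *ᵥ xt) (f i)‖ ^ 2 := by
        simp only [hrow]
    _ = ∑ r ∈ Finset.univ.image f, ‖(U *ᵥ xt) r‖ ^ 2 := by
        rw [Finset.sum_image (fun i _ i' _ h => hf h)]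
    _ ≤ ∑ r, ‖(U *ᵥ xt) r‖ ^ 2 :=
        Finset.sum_le_sum_of_subset_of_nonneg (Finset.subset_univ _) fun r _ _ => by positivity
    _ = ∑ j, ‖x j‖ ^ 2 := by rw [sum_norm_sq_mulVec_unitary hU, hnorm_xt]
    _ = (1 : ℝ) ^ 2 * ∑ j, ‖x j‖ ^ 2 := by rw [one_pow, one_mul]

/-- **`|Per(U_{S,T})| ≤ 1`**: the permanent of any square submatrix (distinct rows `f`, distinct
columns `g`) of a unitary has modulus at most `1` — Corollary 65 with `‖V‖ ≤ 1`; in particular every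
collision-free boson-sampling amplitude `⟨S|φ(U)|T⟩ = Per(U_{S,T})` lies in the unit disc.
[cite: AaronsonArkhipov2011, App. 12 Corollary 65 (full version arXiv:1011.3245)] -/
theorem norm_permanent_submatrix_unitary_le_one {m : Type*} [Fintype m] [DecidableEq m]
    {U : _root_.Matrix m m ℂ} (hU : U ∈ _root_.Matrix.unitaryGroup m ℂ) {f g : ι → m}
    (hf : Function.Injective f) (hg : Function.Injective g) :
    ‖(_root_.Matrix.of fun i j => U (f i) (g j)).permanent‖ ≤ 1 := by
  have h := norm_permanent_le_pow (_root_.Matrix.of fun i j => U (f i) (g j)) zero_le_one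
    (fun x => by simpa only [Matrix.of_apply] using sum_norm_sq_submatrix_mulVec_le hU hf hg x)
  simpa only [one_pow] using h

end Literature.Analysis.Matrix
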